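import Literature.Probability.Percolation.ZdNearCriticalWindow
import Literature.Probability.Percolation.ProdBernoulliRusso
import Literature.Probability.RandomPlanarGeometry.PlanarDomains
import Summits.CriticalPhenomena.CardyFormulaZ2.Theorems.ModulusResponseBondIdentification
import Summits.CriticalPhenomena.CardyFormulaZ2.Theorems.CardyUSTContinuationBernoulliEndpoint
import HarnessLib

/-!
# Stub `stub_russoDefectForm` of line `registered` (crux stmt-CriticalPhenomena-6468
# `SmirnovResponse`, route ModulusResponse): the finite-mesh response IS Russo's defect sum

The crux pins `μ_u = (setBer(univ, 1/2) ⊗ setBer(univ, u)).map cell`: the cell map opens, at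
every vertex `m` of `ℤ²`, the LEFT edge `s(m - e₀, m)` iff `m ∈ X` and the DOWN edge
`v_m = s(m - e₁, m)` iff `(m ∈ X ↔ m ∉ D)` (`X` fair coins, `D ~ Ber(u)` the defects). The stub:
for every conformal rectangle `R`, pre-stretch `t` and `δ > 0`, `u ↦ μ_u[C_δ(S_t R)]` has at
`u = 0`, within `[0, ∞)`, the derivative `Σᶠ_m (μ_0[{ω | ω Δ {v_m} ∈ C_δ}] - μ_0[C_δ])`. Honest
finite-mesh calculus (no scaling limit; no auxiliary definition — the cell configuration is the
local NOTATION `cell⟪X, D⟫` for the set written out in the crux):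
* LOCALITY: `C_δ` only reads the edges of `Ω_δ` (`mem_discreteCrossing_iff_of_inter_edgeSet_eq`,
  in tree), on which `cell⟪X, D⟫` only reads the bits of the vertices of `Ω_δ`
  (`cell_inter_edgeSet_congr`); for a finite `T ⊇ meshDomain Ω δ` the event
  `{(X, D) | cell⟪X, D⟫ ∈ C_δ}` splits along the defect cylinders `[D']_T`
  (`preimage_cell_eq_biUnion`).
* DEFECT EXPANSION (`map_cell_real_eq_sum`): for a coin law `P` and `u ∈ [0, 1]`,
  `((P ⊗ setBer(univ, u)).map cell)[C_δ] = Σ_{D' ⊆ T} u^{|D'|} (1 - u)^{|T| - |D'|} h(D')`,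
  `h(D') = P{X | cell⟪X, D'⟫ ∈ C_δ}` — a polynomial in `u`.
* RUSSO SUM: its right derivative at `0` is `Σ_{m ∈ T} (h({m}) - h(∅))`
  (`hasDerivAt_defectPolynomial`, `hasDerivWithinAt_map_cell_real`).
* IDENTIFICATION: `μ_0` is the law of `cell⟪X, ∅⟫` (`setBer(univ, 0) = δ_∅`) and
  `cell⟪X, ∅⟫ Δ {v_m} = cell⟪X, {m}⟫` (`cell_empty_symmDiff`), so the flipped `u = 0`
  probabilities are the `h({m})`; cells off the finite `Ω_δ` (`meshDomain_finite`) contribute `0`.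
-/

noncomputable section

namespace Summit.CriticalPhenomena.CardyFormulaZ2.Theorems

namespace RussoDefectForm

open MeasureTheory ProbabilityTheory
open Literature.Probability.Percolation Literature.Probability.LatticeModels

set_option quotPrecheck false in
/-- `cell⟪X, D⟫`: the cell configuration of the crux for coins `X` and defects `D` (notation). -/
local notation "cell⟪" X ", " D "⟫" =>
  ({e : Sym2 (Site 2) | ∃ m, (m ∈ X ∧ e = s(m - Pi.single 0 1, m)) ∨
    ((m ∈ X ↔ m ∉ D) ∧ e = s(m - Pi.single 1 1, m))} : Set (Sym2 (Site 2)))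

/-- The endpoints of an edge of `Ω_δ` are vertices of `Ω_δ`. [folklore] -/
private theorem mem_meshDomain_of_mem_edgeSet {Ω : Set ℂ} {δ : ℝ} {e : Sym2 (Site 2)}
    (he : e ∈ (discreteDomainGraph Ω δ).edgeSet) {x : Site 2} (hx : x ∈ e) :
    x ∈ meshDomain Ω δ := by
  induction e using Sym2.ind with
  | h a b =>
    rw [SimpleGraph.mem_edgeSet, discreteDomainGraph_adj_iff] at he
    rcases Sym2.mem_iff.1 hx with rfl | rfl
    exacts [he.2.1, he.2.2]

/-- If two (coin, defect) pairs agree on a set `T` of vertices, an edge with both endpoints in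
`T` open in the first cell configuration is open in the second (the left/down edge
`s(m - e_j, m)` of `m` reads the bits of `m` only). [folklore] -/
private theorem mem_cell_of_mem_cell {T X X' D D' : Set (Site 2)}
    (hX : ∀ m ∈ T, m ∈ X ↔ m ∈ X') (hD : ∀ m ∈ T, m ∈ D ↔ m ∈ D') {e : Sym2 (Site 2)}
    (heT : ∀ x ∈ e, x ∈ T)
    (he : e ∈ cell⟪X, D⟫) : e ∈ cell⟪X', D'⟫ := by
  obtain ⟨m, ⟨hm, rfl⟩ | ⟨hm, rfl⟩⟩ := he
  · exact ⟨m, Or.inl ⟨(hX m (heT m (Sym2.mem_mk_right _ _))).1 hm, rfl⟩⟩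
  · have hmT : m ∈ T := heT m (Sym2.mem_mk_right _ _)
    exact ⟨m, Or.inr ⟨by rw [← hX m hmT, ← hD m hmT]; exact hm, rfl⟩⟩

/-- LOCALITY OF THE CELL MAP ON `Ω_δ`: if `T ⊇ meshDomain Ω δ` and two (coin, defect) pairs
agree on `T`, the two cell configurations agree on the edges of `Ω_δ`. [folklore] -/
theorem cell_inter_edgeSet_congr {Ω : Set ℂ} {δ : ℝ} {T : Set (Site 2)}
    (hT : meshDomain Ω δ ⊆ T) {X X' D D' : Set (Site 2)} (hX : ∀ m ∈ T, m ∈ X ↔ m ∈ X')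
    (hD : ∀ m ∈ T, m ∈ D ↔ m ∈ D') :
    cell⟪X, D⟫ ∩ (discreteDomainGraph Ω δ).edgeSet =
      cell⟪X', D'⟫ ∩ (discreteDomainGraph Ω δ).edgeSet := by
  ext e
  simp only [Set.mem_inter_iff]
  constructor
  · rintro ⟨he, heF⟩
    exact ⟨mem_cell_of_mem_cell hX hD
      (fun x hx => hT (mem_meshDomain_of_mem_edgeSet heF hx)) he, heF⟩
  · rintro ⟨he, heF⟩
    exact ⟨mem_cell_of_mem_cell (fun m hm => (hX m hm).symm) (fun m hm => (hD m hm).symm)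
      (fun x hx => hT (mem_meshDomain_of_mem_edgeSet heF hx)) he, heF⟩

/-- Consequently the crossing event, read through the cell map, only depends on the coins and
the defects of the vertices of `T ⊇ meshDomain Ω δ`. [folklore] -/
theorem cell_mem_discreteCrossing_congr {Ω : Set ℂ} {δ : ℝ} {A B : Set ℂ} {T : Set (Site 2)}
    (hT : meshDomain Ω δ ⊆ T) {X X' D D' : Set (Site 2)} (hX : ∀ m ∈ T, m ∈ X ↔ m ∈ X')
    (hD : ∀ m ∈ T, m ∈ D ↔ m ∈ D') :
    cell⟪X, D⟫ ∈ discreteCrossing Ω δ A B ↔ cell⟪X', D'⟫ ∈ discreteCrossing Ω δ A B :=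
  mem_discreteCrossing_iff_of_inter_edgeSet_eq (cell_inter_edgeSet_congr hT hX hD)

/-- DEFECT CYLINDER DECOMPOSITION: for a finite `T ⊇ meshDomain Ω δ`, the event
`{(X, D) | cell⟪X, D⟫ ∈ C_δ}` is the union over `D' ⊆ T` of the products
`{X | cell⟪X, D'⟫ ∈ C_δ} × [D']_T`. [folklore] -/
theorem preimage_cell_eq_biUnion {Ω : Set ℂ} {δ : ℝ} {A B : Set ℂ} {T : Finset (Site 2)}
    (hT : meshDomain Ω δ ⊆ ↑T) :
    (fun p : Set (Site 2) × Set (Site 2) => cell⟪p.1, p.2⟫) ⁻¹' discreteCrossing Ω δ A B =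
      ⋃ D' ∈ T.powerset, {X : Set (Site 2) | cell⟪X, (↑D' : Set (Site 2))⟫ ∈
        discreteCrossing Ω δ A B} ×ˢ localCylinder (↑T : Set (Site 2)) ↑D' := by
  classical
  ext ⟨X, D⟩
  simp only [Set.mem_preimage, Set.mem_iUnion, Set.mem_prod, Set.mem_setOf_eq, exists_prop,
    Finset.mem_powerset]
  constructor
  · intro h
    refine ⟨T.filter (· ∈ D), Finset.filter_subset _ _, ?_, ?_⟩
    · refine (cell_mem_discreteCrossing_congr hT (fun m _ => Iff.rfl) (fun m hm => ?_)).1 h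
      simp only [Finset.coe_filter, Set.mem_setOf_eq]
      exact ⟨fun hmD => ⟨hm, hmD⟩, fun h' => h'.2⟩
    · intro i hi
      simp only [Finset.coe_filter, Set.mem_setOf_eq]
      exact ⟨fun hiD => ⟨hi, hiD⟩, fun h' => h'.2⟩
  · rintro ⟨D', -, hE, hcyl⟩
    exact (cell_mem_discreteCrossing_congr hT (fun m _ => Iff.rfl) hcyl).2 hE

/-- The cylinder probabilities of the homogeneous product Bernoulli measure:
`setBer(univ, q)([D']_T) = q^{|D'|} (1 - q)^{|T| - |D'|}` for `D' ⊆ T`. [folklore] -/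
private theorem setBernoulli_real_localCylinder (q : unitInterval) {T D' : Finset (Site 2)}
    (hD' : D' ⊆ T) :
    (setBer((Set.univ : Set (Site 2)), q)).real (localCylinder (↑T : Set (Site 2)) ↑D') =
      (q : ℝ) ^ D'.card * (1 - (q : ℝ)) ^ (T.card - D'.card) := by
  rw [← prodBernoulli_const, prodBernoulli_real_localCylinder]
  calc _ = ∏ i ∈ T, (if i ∈ D' then (q : ℝ) else 1 - (q : ℝ)) := by
        refine Finset.prod_congr rfl fun i _ => ?_
        by_cases h : i ∈ D' <;> simp [h]
    _ = (q : ℝ) ^ D'.card * (1 - (q : ℝ)) ^ (T.card - D'.card) := by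
        rw [Finset.prod_ite, Finset.prod_const, Finset.prod_const, Finset.filter_not,
          Finset.filter_mem_eq_inter, Finset.inter_eq_right.2 hD',
          Finset.card_sdiff_of_subset hD']

/-- The cell map at a fixed defect set `D`, `X ↦ cell⟪X, D⟫`, is measurable. [folklore] -/
private theorem measurable_cell_left (D : Set (Site 2)) :
    Measurable fun X : Set (Site 2) => cell⟪X, D⟫ :=
  BondIdent.measurable_cellMap.comp measurable_prodMk_right

/-- **DEFECT EXPANSION.** For a probability law `P` of the coins, `u ∈ [0, 1]` and a finite
`T ⊇ meshDomain Ω δ`: `((P ⊗ setBer(univ, u)).map cell)[C_δ(Ω; A, B)]` equals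
`Σ_{D' ⊆ T} u^{|D'|} (1-u)^{|T|-|D'|} · P{X | cell⟪X, D'⟫ ∈ C_δ}` (condition on the defect set:
its trace on `T` is `D'` with probability `u^{|D'|} (1-u)^{|T|-|D'|}`, independently of the
coins). In particular `u ↦ μ_u[C_δ]` is a polynomial on `[0, 1]`. [folklore] -/
theorem map_cell_real_eq_sum {Ω : Set ℂ} {δ : ℝ} {A B : Set ℂ} {T : Finset (Site 2)}
    (hT : meshDomain Ω δ ⊆ ↑T) (P : Measure (Set (Site 2))) [IsProbabilityMeasure P]
    {u : ℝ} (hu : u ∈ Set.Icc (0 : ℝ) 1) :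
    (Measure.map (fun p : Set (Site 2) × Set (Site 2) => cell⟪p.1, p.2⟫)
        (P.prod (setBer((Set.univ : Set (Site 2)), Set.projIcc 0 1 zero_le_one u)))).real
        (discreteCrossing Ω δ A B) =
      ∑ D' ∈ T.powerset, u ^ D'.card * (1 - u) ^ (T.card - D'.card) *
        P.real {X : Set (Site 2) | cell⟪X, (↑D' : Set (Site 2))⟫ ∈ discreteCrossing Ω δ A B} := by
  rw [map_measureReal_apply BondIdent.measurable_cellMap
      (measurableSet_discreteCrossing Ω δ A B),
    preimage_cell_eq_biUnion hT, measureReal_biUnion_finset]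
  · refine Finset.sum_congr rfl fun D' hD' => ?_
    rw [measureReal_prod_prod, setBernoulli_real_localCylinder _ (Finset.mem_powerset.1 hD'),
      Set.projIcc_of_mem zero_le_one hu]
    ring
  · intro D' hD' D'' hD'' hne
    exact Set.disjoint_prod.2 (Or.inr (Russo.disjoint_localCylinder
      (Finset.mem_powerset.1 hD') (Finset.mem_powerset.1 hD'') hne))
  · intro D' _
    exact ((measurable_cell_left _) (measurableSet_discreteCrossing Ω δ A B)).prod
      (measurableSet_localCylinder (Finset.countable_toSet T) _)

/-- `d/du (u^a (1-u)^b) |_{u=0} = [a = 1] - [a = 0] · b`. [folklore] -/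
private theorem hasDerivAt_pow_mul_one_sub_pow (a b : ℕ) :
    HasDerivAt (fun u : ℝ => u ^ a * (1 - u) ^ b)
      ((if a = 1 then (1 : ℝ) else 0) - (if a = 0 then (b : ℝ) else 0)) 0 := by
  have h1 : HasDerivAt (fun u : ℝ => u ^ a) ((a : ℝ) * (0 : ℝ) ^ (a - 1)) 0 := hasDerivAt_pow a 0
  have h2 : HasDerivAt (fun u : ℝ => (1 - u) ^ b) ((b : ℝ) * (1 - 0) ^ (b - 1) * (-1)) 0 :=
    ((hasDerivAt_id' (0 : ℝ)).const_sub 1).pow b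
  have hf : (fun u : ℝ => u ^ a * (1 - u) ^ b) =
      (fun u : ℝ => u ^ a) * (fun u : ℝ => (1 - u) ^ b) := rfl
  rw [hf]
  refine (h1.mul h2).congr_deriv ?_
  rcases a with _ | _ | a
  · simp
  · simp
  · simp

/-- THE DEFECT POLYNOMIAL AND ITS DERIVATIVE AT `0`: for any weights `h`,
`d/du Σ_{D' ⊆ T} u^{|D'|} (1-u)^{|T|-|D'|} h(D') |_{u=0} = Σ_{m ∈ T} (h({m}) - h(∅))`
(only `|D'| ≤ 1` contributes to first order). [folklore] -/
theorem hasDerivAt_defectPolynomial {α : Type*} [DecidableEq α] (T : Finset α)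
    (h : Finset α → ℝ) :
    HasDerivAt (fun u : ℝ => ∑ D' ∈ T.powerset, u ^ D'.card * (1 - u) ^ (T.card - D'.card) * h D')
      (∑ m ∈ T, (h {m} - h ∅)) 0 := by
  have hg : HasDerivAt (fun u : ℝ => ∑ D' ∈ T.powerset, u ^ D'.card * (1 - u) ^
      (T.card - D'.card) * h D') (∑ D' ∈ T.powerset, ((if D'.card = 1 then (1 : ℝ) else 0) -
        (if D'.card = 0 then ((T.card - D'.card : ℕ) : ℝ) else 0)) * h D') 0 :=
    HasDerivAt.fun_sum fun D' _ => (hasDerivAt_pow_mul_one_sub_pow _ _).mul_const _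
  convert hg using 1
  rw [Finset.sum_sub_distrib]
  simp_rw [sub_mul, Finset.sum_sub_distrib, ite_mul, zero_mul, one_mul]
  congr 1
  · rw [← Finset.sum_filter, ← Finset.powersetCard_eq_filter, Finset.powersetCard_one,
      Finset.sum_map]
    rfl
  · simp_rw [Finset.card_eq_zero]
    rw [Finset.sum_ite_eq' T.powerset ∅, if_pos (Finset.empty_mem_powerset T), Finset.card_empty,
      Nat.sub_zero, Finset.sum_const, nsmul_eq_mul]

/-- **RUSSO'S DEFECT SUM (finite mesh).** For a probability law `P` of the coins and a finite
`T ⊇ meshDomain Ω δ`, the map `u ↦ ((P ⊗ setBer(univ, u)).map cell)[C_δ(Ω; A, B)]` has, at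
`u = 0` within `[0, ∞)`, the derivative
`Σ_{m ∈ T} (P{X | cell⟪X, {m}⟫ ∈ C_δ} - P{X | cell⟪X, ∅⟫ ∈ C_δ})`: the sum over the cells of
(probability with one defect at `m`) minus (probability with no defect). [folklore] -/
theorem hasDerivWithinAt_map_cell_real {Ω : Set ℂ} {δ : ℝ} {A B : Set ℂ} {T : Finset (Site 2)}
    (hT : meshDomain Ω δ ⊆ ↑T) (P : Measure (Set (Site 2))) [IsProbabilityMeasure P] :
    HasDerivWithinAt (fun u : ℝ =>
      (Measure.map (fun p : Set (Site 2) × Set (Site 2) => cell⟪p.1, p.2⟫)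
        (P.prod (setBer((Set.univ : Set (Site 2)), Set.projIcc 0 1 zero_le_one u)))).real
        (discreteCrossing Ω δ A B))
      (∑ m ∈ T, (P.real {X : Set (Site 2) | cell⟪X, ({m} : Set (Site 2))⟫ ∈
          discreteCrossing Ω δ A B} -
        P.real {X : Set (Site 2) | cell⟪X, (∅ : Set (Site 2))⟫ ∈ discreteCrossing Ω δ A B}))
      (Set.Ici 0) 0 := by
  classical
  have key := (hasDerivAt_defectPolynomial T (fun D' : Finset (Site 2) =>
    P.real {X : Set (Site 2) | cell⟪X, (↑D' : Set (Site 2))⟫ ∈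
      discreteCrossing Ω δ A B})).hasDerivWithinAt (s := Set.Ici 0)
  simp only [Finset.coe_singleton, Finset.coe_empty] at key
  refine key.congr_of_eventuallyEq ?_ (map_cell_real_eq_sum hT P ⟨le_rfl, zero_le_one⟩)
  filter_upwards [Icc_mem_nhdsGE (zero_lt_one' ℝ)] with u hu using map_cell_real_eq_sum hT P hu

/-- THE `u = 0` LAW: with no defects (`projIcc 0 1 0 = 0`, `setBer(univ, 0) = δ_∅`) the cell
measure is the law of `X ↦ cell⟪X, ∅⟫` under the coin law `P`. [folklore] -/
theorem map_cell_zero_eq (P : Measure (Set (Site 2))) [SFinite P] :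
    Measure.map (fun p : Set (Site 2) × Set (Site 2) => cell⟪p.1, p.2⟫)
        (P.prod (setBer((Set.univ : Set (Site 2)), Set.projIcc 0 1 zero_le_one 0))) =
      P.map (fun X : Set (Site 2) => cell⟪X, (∅ : Set (Site 2))⟫) := by
  rw [show Set.projIcc (0 : ℝ) 1 zero_le_one 0 = 0 by rw [Set.projIcc_left]; rfl,
    setBernoulli_zero, Measure.prod_dirac,
    Measure.map_map BondIdent.measurable_cellMap measurable_prodMk_right]
  rfl

/-- Flipping one fixed edge, `ω ↦ ω Δ {v}`, is measurable. [folklore] -/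
private theorem measurable_symmDiff_singleton (v : Sym2 (Site 2)) :
    Measurable fun ω : BondConfig (Site 2) => symmDiff ω {v} := by
  refine measurable_set_iff.2 fun e => ?_
  rw [show (fun ω : BondConfig (Site 2) => e ∈ symmDiff ω {v}) = fun ω => (e ∈ ω ∧
      e ∉ ({v} : Set (Sym2 (Site 2)))) ∨ (e ∈ ({v} : Set (Sym2 (Site 2))) ∧ e ∉ ω) from
    funext fun ω => propext Set.mem_symmDiff]
  exact ((measurable_set_mem e).and measurable_const).or
    (measurable_const.and (measurable_set_notMem e))

/-- THE ONE-DEFECT FLIP: flipping the down edge `v_m = s(m - e₁, m)` of the defect-free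
configuration `cell⟪X, ∅⟫` gives `cell⟪X, {m}⟫`, one defect at `m` (distinct
(vertex, direction) pairs give distinct edges, `BondIdent.mk_sub_single_inj`). [folklore] -/
theorem cell_empty_symmDiff (X : Set (Site 2)) (m : Site 2) :
    symmDiff cell⟪X, (∅ : Set (Site 2))⟫ {s(m - Pi.single 1 1, m)} =
      cell⟪X, ({m} : Set (Site 2))⟫ := by
  ext e
  simp only [Set.mem_symmDiff, Set.mem_singleton_iff, Set.mem_setOf_eq, Set.mem_empty_iff_false,
    not_false_iff, iff_true]
  by_cases hev : e = s(m - Pi.single 1 1, m)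
  · subst hev
    -- the flipped edge itself: open with one defect iff `m ∉ X`
    have hL : (∃ m', (m' ∈ X ∧ s(m - Pi.single 1 1, m) = s(m' - Pi.single 0 1, m')) ∨
        (m' ∈ X ∧ s(m - Pi.single 1 1, m) = s(m' - Pi.single 1 1, m'))) ↔ m ∈ X := by
      constructor
      · rintro ⟨m', ⟨hm', h⟩ | ⟨hm', h⟩⟩
        · exact absurd (BondIdent.mk_sub_single_inj h).2 (by decide)
        · rwa [(BondIdent.mk_sub_single_inj h).1]
      · exact fun hm => ⟨m, Or.inr ⟨hm, rfl⟩⟩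
    have hR : (∃ m', (m' ∈ X ∧ s(m - Pi.single 1 1, m) = s(m' - Pi.single 0 1, m')) ∨
        ((m' ∈ X ↔ ¬ m' = m) ∧ s(m - Pi.single 1 1, m) = s(m' - Pi.single 1 1, m'))) ↔
          m ∉ X := by
      constructor
      · rintro ⟨m', ⟨hm', h⟩ | ⟨hm', h⟩⟩
        · exact absurd (BondIdent.mk_sub_single_inj h).2 (by decide)
        · have hmm : m = m' := (BondIdent.mk_sub_single_inj h).1
          subst hmm
          exact fun hm => (hm'.1 hm) rfl
      · exact fun hm => ⟨m, Or.inr ⟨⟨fun h => absurd h hm, fun h => absurd rfl h⟩, rfl⟩⟩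
    rw [hR]
    simp only [hL, not_true_eq_false, and_false, true_and, false_or]
  · simp only [hev, not_false_eq_true, and_true, false_and, or_false]
    refine exists_congr fun m' => or_congr Iff.rfl (and_congr_left fun h => ?_)
    have hm' : ¬ m' = m := fun hmm => hev (hmm ▸ h)
    simp only [hm', not_false_eq_true, iff_true]

/-- THE ONE-DEFECT TERM: under the law of `cell⟪X, ∅⟫`, the flipped event `{ω | ω Δ {v_m} ∈ E}`
has probability `P{X | cell⟪X, {m}⟫ ∈ E}`. [folklore] -/
theorem map_noDefect_real_flip_preimage (P : Measure (Set (Site 2))) (m : Site 2)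
    {E : Set (BondConfig (Site 2))} (hE : MeasurableSet E) :
    (P.map (fun X : Set (Site 2) => cell⟪X, (∅ : Set (Site 2))⟫)).real
        ((fun ω ↦ symmDiff ω {s(m - Pi.single 1 1, m)}) ⁻¹' E) =
      P.real {X : Set (Site 2) | cell⟪X, ({m} : Set (Site 2))⟫ ∈ E} := by
  rw [map_measureReal_apply (measurable_cell_left _) (measurable_symmDiff_singleton _ hE)]
  congr 1
  ext X
  simp only [Set.mem_preimage, Set.mem_setOf_eq]
  rw [cell_empty_symmDiff X m]

/-- The diagonal stretch `S_t z = cosh t · z + i sinh t · z̄` maps bounded sets to bounded sets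
(it is continuous), so for `δ > 0` the discrete domain of the stretched conformal rectangle is
a `Finset` of vertices of `ℤ²` (`meshDomain_finite`). [folklore] -/
theorem exists_meshDomain_eq_coe (S : ℝ → ℂ → ℂ)
    (hS : ∀ t z, S t z = (Real.cosh t : ℂ) * z + Complex.I * (Real.sinh t : ℂ) * (starRingEnd ℂ) z)
    (R : Literature.Probability.RandomPlanarGeometry.ConformalRectangle) (t : ℝ) {δ : ℝ}
    (hδ : 0 < δ) : ∃ T : Finset (Site 2), meshDomain (S t '' R.carrier) δ = ↑T := by
  have hc : Continuous (S t) := by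
    rw [show S t = fun z =>
      (Real.cosh t : ℂ) * z + Complex.I * (Real.sinh t : ℂ) * (starRingEnd ℂ) z from funext (hS t)]
    fun_prop
  have hb : Bornology.IsBounded (S t '' R.carrier) :=
    (R.isBounded.isCompact_closure.image hc).isBounded.subset (Set.image_mono subset_closure)
  exact ⟨(meshDomain_finite hb hδ).toFinset, (Set.Finite.coe_toFinset _).symm⟩

end RussoDefectForm

open MeasureTheory ProbabilityTheory
open Literature.Probability.Percolation Literature.Probability.LatticeModels

/-- **Stub `stub_russoDefectForm` (RUSSO DEFECT FORM, the finite-mesh backbone).** For the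
pinned `μ`, `S`, every conformal rectangle `R`, pre-stretch `t` and mesh `δ > 0`, the map
`u ↦ μ_u[cross_δ S_t R]` has, within `[0, ∞)` at `u = 0`, the derivative
`Σᶠ_m (μ_0[flip_m ω ∈ cross] − μ_0[cross])`, `flip_m ω = ω Δ {s(m - e₁, m)}` (defect expansion
`RussoDefectForm.map_cell_real_eq_sum`, its derivative `hasDerivWithinAt_map_cell_real`, and the
one-defect terms as flipped `u = 0` probabilities, `map_noDefect_real_flip_preimage`). [folklore] -/
theorem stub_russoDefectForm :
    ∀ (μ : ℝ → MeasureTheory.Measure (Literature.Probability.Percolation.BondConfig (Literature.Probability.LatticeModels.Site 2))) (S : ℝ → ℂ → ℂ), (∀ u, μ u = MeasureTheory.Measure.map (fun p : Set (Literature.Probability.LatticeModels.Site 2) × Set (Literature.Probability.LatticeModels.Site 2) ↦ {e | ∃ m, (m ∈ p.1 ∧ e = s(m - Pi.single 0 1, m)) ∨ ((m ∈ p.1 ↔ m ∉ p.2) ∧ e = s(m - Pi.single 1 1, m))}) ((ProbabilityTheory.setBernoulli Set.univ Literature.Probability.Percolation.half).prod (ProbabilityTheory.setBernoulli Set.univ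 (Set.projIcc 0 1 zero_le_one u)))) → (∀ t z, S t z = (Real.cosh t : ℂ) * z + Complex.I * (Real.sinh t : ℂ) * (starRingEnd ℂ) z) → ∀ (R : Literature.Probability.RandomPlanarGeometry.ConformalRectangle) (t δ : ℝ), 0 < δ → HasDerivWithinAt (fun u ↦ (μ u).real (Literature.Probability.Percolation.discreteCrossing (S t '' R.carrier) δ (S t '' R.arc 0) (S t '' R.arc 2))) (finsum (fun m : Literature.Probability.LatticeModels.Site 2 ↦ (μ 0).real ((fun ω ↦ symmDiff ω {s(m - Pi.single 1 1, m)}) ⁻¹' Literature.Probability.Percolation.discreteCrossing (S t '' R.carrier) δ (S t '' R.arc 0) (S t '' R.arc 2)) - (μ 0).real (Literature.Probability.Percolation.discreteCrossing (S t '' R.carrier) δ (S t '' R.arc 0) (S t '' R.arc 2)))) (Set.Ici 0) 0 := by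
  intro μ S hμ hS R t δ hδ
  obtain ⟨T, hT⟩ := RussoDefectForm.exists_meshDomain_eq_coe S hS R t hδ
  have hE := measurableSet_discreteCrossing (S t '' R.carrier) δ (S t '' R.arc 0) (S t '' R.arc 2)
  -- the `u = 0` law is the law of the defect-free cell configuration under the fair coins
  have hμ0 : μ 0 = (setBernoulli (Set.univ : Set (Site 2)) half).map (fun X : Set (Site 2) =>
      {e : Sym2 (Site 2) | ∃ m, (m ∈ X ∧ e = s(m - Pi.single 0 1, m)) ∨
        ((m ∈ X ↔ m ∉ (∅ : Set (Site 2))) ∧ e = s(m - Pi.single 1 1, m))}) := by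
    rw [hμ]
    exact RussoDefectForm.map_cell_zero_eq _
  -- each term of the `finsum` is (one defect at `m`) minus (no defect)
  have hterm : ∀ m : Site 2,
      (μ 0).real ((fun ω ↦ symmDiff ω {s(m - Pi.single 1 1, m)}) ⁻¹'
          discreteCrossing (S t '' R.carrier) δ (S t '' R.arc 0) (S t '' R.arc 2)) -
        (μ 0).real (discreteCrossing (S t '' R.carrier) δ (S t '' R.arc 0) (S t '' R.arc 2)) =
      (setBernoulli (Set.univ : Set (Site 2)) half).real {X : Set (Site 2) |
          {e : Sym2 (Site 2) | ∃ m', (m' ∈ X ∧ e = s(m' - Pi.single 0 1, m')) ∨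
            ((m' ∈ X ↔ m' ∉ ({m} : Set (Site 2))) ∧ e = s(m' - Pi.single 1 1, m'))} ∈
              discreteCrossing (S t '' R.carrier) δ (S t '' R.arc 0) (S t '' R.arc 2)} -
        (setBernoulli (Set.univ : Set (Site 2)) half).real {X : Set (Site 2) |
          {e : Sym2 (Site 2) | ∃ m', (m' ∈ X ∧ e = s(m' - Pi.single 0 1, m')) ∨
            ((m' ∈ X ↔ m' ∉ (∅ : Set (Site 2))) ∧ e = s(m' - Pi.single 1 1, m'))} ∈
              discreteCrossing (S t '' R.carrier) δ (S t '' R.arc 0) (S t '' R.arc 2)} := by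
    intro m
    rw [hμ0, RussoDefectForm.map_noDefect_real_flip_preimage _ m hE,
      map_measureReal_apply (RussoDefectForm.measurable_cell_left _) hE]
    rfl
  -- cells off the discrete domain do not contribute
  have hsupp : Function.support (fun m : Literature.Probability.LatticeModels.Site 2 ↦
      (μ 0).real ((fun ω ↦ symmDiff ω {s(m - Pi.single 1 1, m)}) ⁻¹'
        Literature.Probability.Percolation.discreteCrossing (S t '' R.carrier) δ (S t '' R.arc 0)
          (S t '' R.arc 2)) -
      (μ 0).real (Literature.Probability.Percolation.discreteCrossing (S t '' R.carrier) δ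
        (S t '' R.arc 0) (S t '' R.arc 2))) ⊆ ↑T := by
    intro m hm
    by_contra hmT
    apply hm
    dsimp only
    rw [hterm m, sub_eq_zero]
    congr 1
    ext X
    exact RussoDefectForm.cell_mem_discreteCrossing_congr hT.subset (fun _ _ => Iff.rfl)
      fun m' hm' => ⟨fun h => absurd hm' (by rw [Set.mem_singleton_iff.1 h]; exact hmT),
        fun h => absurd h (Set.notMem_empty _)⟩
  rw [finsum_eq_sum_of_support_subset _ hsupp, Finset.sum_congr rfl fun m _ => hterm m]
  have hfun : (fun u ↦ (μ u).real
      (discreteCrossing (S t '' R.carrier) δ (S t '' R.arc 0) (S t '' R.arc 2))) =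
      fun u ↦ (Measure.map (fun p : Set (Site 2) × Set (Site 2) ↦
        {e | ∃ m, (m ∈ p.1 ∧ e = s(m - Pi.single 0 1, m)) ∨
          ((m ∈ p.1 ↔ m ∉ p.2) ∧ e = s(m - Pi.single 1 1, m))})
        ((setBernoulli Set.univ half).prod
          (setBernoulli Set.univ (Set.projIcc 0 1 zero_le_one u)))).real
        (discreteCrossing (S t '' R.carrier) δ (S t '' R.arc 0) (S t '' R.arc 2)) :=
    funext fun u => by rw [hμ]
  rw [hfun]
  exact RussoDefectForm.hasDerivWithinAt_map_cell_real hT.subset _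

end Summit.CriticalPhenomena.CardyFormulaZ2.Theorems

end
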